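import Mathlib
import Summits.ValiantsHypothesis.ValiantsHypothesis.Theses.FreeFermionCLL

/-!
# `FreeFermionCLL.SharpImpliesExp` (stmt-ValiantsHypothesis-13559) — the sharp rank law implies the exchange-rate law

Route `ValiantsHypothesis/FreeFermionCLL`, support item `SharpImpliesExp : SharpRankLaw → ExpRankLaw`.

`SharpRankLaw` gives one `C : ℕ` with, for all `n ≥ 1`, `R`, `K`, `κ`,
`‖permMass P⁽ⁿ⁾‖² ≤ C · n^C · e^{-n} · (R+1)^{1/ln 2} · (n! · coeffNormSq P⁽ⁿ⁾)`;
`ExpRankLaw` asks for `C'` and `0 < θ < 1` with, for ALL `n`, `R`, `K`, `κ`,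
`‖permMass P⁽ⁿ⁾‖² ≤ C' · (R+n+1)^{C'} · θ^n · (n! · coeffNormSq P⁽ⁿ⁾)`.

Bookkeeping (pure real arithmetic, `sharp_to_exp_bookkeeping`): take `θ = e^{-1}` and
`C' = C + 2`.  For `n ≥ 1`: `C ≤ C + 2`, `n^C ≤ (R+n+1)^C`, and
`(R+1)^{1/ln 2} ≤ (R+1)^2 ≤ (R+n+1)^2` (`rpow_one_div_log_two_le_sq`: `R + 1 ≥ 1` and
`1/ln 2 ≤ 2` since `ln 2 > 0.69`, `Real.log_two_gt_d9`); finally `e^{-n} = (e^{-1})^n`.  For `n = 0` the sharp law says nothing, but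
Cauchy–Schwarz over the permutation monomials (`norm_permMass_sq_le`:
`‖permMass f‖² ≤ n! · coeffNormSq f`) together with `1 ≤ (C+2) · (R+1)^{C+2}` does it.
No literature input beyond the tree's `PermanentCorrelation.lean`. [folklore]
-/

-- `Summit.ValiantsHypothesis.ValiantsHypothesis.…` is the tree's mandated single-conjunct layout (Sub = Summit).
set_option linter.dupNamespace false

namespace Summit.ValiantsHypothesis.ValiantsHypothesis.Theorems.FreeFermionCLL

open Literature.Computability.AlgebraicComplexity

/-- For `1 ≤ x`: `x ^ (1 / ln 2) ≤ x ^ 2` (real power versus natural power; `1 / ln 2 ≤ 2`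
because `ln 2 > 0.6931`, `Real.log_two_gt_d9`). [folklore] -/
theorem rpow_one_div_log_two_le_sq {x : ℝ} (hx : 1 ≤ x) :
    x ^ (1 / Real.log 2) ≤ x ^ 2 := by
  have hlog := Real.log_two_gt_d9
  have hexp : 1 / Real.log 2 ≤ 2 := by
    rw [div_le_iff₀ (by linarith)]
    linarith
  calc x ^ (1 / Real.log 2) ≤ x ^ (2 : ℝ) := Real.rpow_le_rpow_of_exponent_le hx hexp
    _ = x ^ 2 := Real.rpow_two x

/-- The real-arithmetic bookkeeping behind `SharpImpliesExp`: if `M ≤ n!·Q` (Cauchy–Schwarz) and,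
for `n ≥ 1`, `M ≤ C · n^C · e^{-n} · (R+1)^{1/ln 2} · (n!·Q)` with `Q ≥ 0`, then
`M ≤ (C+2) · (R+n+1)^{C+2} · (e^{-1})^n · (n!·Q)` for every `n`. [folklore] -/
theorem sharp_to_exp_bookkeeping {C n R : ℕ} {M Q : ℝ} (hQ : 0 ≤ Q)
    (hCS : M ≤ (n.factorial : ℝ) * Q)
    (hS : 1 ≤ n → M ≤ (C : ℝ) * (n : ℝ) ^ C * Real.exp (-(n : ℝ)) *
      ((R : ℝ) + 1) ^ (1 / Real.log 2) * ((n.factorial : ℝ) * Q)) :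
    M ≤ ((C + 2 : ℕ) : ℝ) * ((R : ℝ) + n + 1) ^ (C + 2) * Real.exp (-1) ^ n *
      ((n.factorial : ℝ) * Q) := by
  have hN0 : 0 ≤ (n.factorial : ℝ) * Q := mul_nonneg (Nat.cast_nonneg _) hQ
  have hR0 : (0 : ℝ) ≤ R := Nat.cast_nonneg R
  have hC' : (1 : ℝ) ≤ ((C + 2 : ℕ) : ℝ) := by
    push_cast
    linarith [(Nat.cast_nonneg C : (0 : ℝ) ≤ C)]
  rcases Nat.eq_zero_or_pos n with rfl | hn
  · -- `n = 0`: Cauchy–Schwarz and `1 ≤ (C+2)·(R+1)^(C+2)`.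
    refine hCS.trans (le_mul_of_one_le_left hN0 ?_)
    rw [pow_zero, mul_one]
    refine one_le_mul_of_one_le_of_one_le hC' (one_le_pow₀ ?_)
    push_cast
    linarith
  · -- `n ≥ 1`: the sharp law, then monotone bookkeeping of the four factors.
    have h1 : (C : ℝ) ≤ ((C + 2 : ℕ) : ℝ) := by exact_mod_cast Nat.le_add_right C 2
    have h2 : (n : ℝ) ^ C ≤ ((R : ℝ) + n + 1) ^ C :=
      pow_le_pow_left₀ (Nat.cast_nonneg n) (by linarith) C
    have h3 : ((R : ℝ) + 1) ^ (1 / Real.log 2) ≤ ((R : ℝ) + n + 1) ^ 2 :=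
      calc ((R : ℝ) + 1) ^ (1 / Real.log 2) ≤ ((R : ℝ) + 1) ^ 2 :=
            rpow_one_div_log_two_le_sq (by linarith)
        _ ≤ ((R : ℝ) + n + 1) ^ 2 :=
            pow_le_pow_left₀ (by linarith) (by linarith [(Nat.cast_nonneg n : (0 : ℝ) ≤ n)]) 2
    have hθ : Real.exp (-1) ^ n = Real.exp (-(n : ℝ)) := by
      rw [← Real.exp_nat_mul, mul_neg_one]
    have key : (C : ℝ) * (n : ℝ) ^ C * ((R : ℝ) + 1) ^ (1 / Real.log 2) ≤
        ((C + 2 : ℕ) : ℝ) * ((R : ℝ) + n + 1) ^ C * ((R : ℝ) + n + 1) ^ 2 :=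
      mul_le_mul (mul_le_mul h1 h2 (by positivity) (by positivity)) h3 (by positivity)
        (by positivity)
    calc M ≤ (C : ℝ) * (n : ℝ) ^ C * Real.exp (-(n : ℝ)) * ((R : ℝ) + 1) ^ (1 / Real.log 2) *
          ((n.factorial : ℝ) * Q) := hS hn
      _ = (C : ℝ) * (n : ℝ) ^ C * ((R : ℝ) + 1) ^ (1 / Real.log 2) * Real.exp (-(n : ℝ)) *
          ((n.factorial : ℝ) * Q) := by ring
      _ ≤ ((C + 2 : ℕ) : ℝ) * ((R : ℝ) + n + 1) ^ C * ((R : ℝ) + n + 1) ^ 2 *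
          Real.exp (-(n : ℝ)) * ((n.factorial : ℝ) * Q) :=
        mul_le_mul_of_nonneg_right
          (mul_le_mul_of_nonneg_right key (Real.exp_pos _).le) hN0
      _ = ((C + 2 : ℕ) : ℝ) * ((R : ℝ) + n + 1) ^ (C + 2) * Real.exp (-1) ^ n *
          ((n.factorial : ℝ) * Q) := by rw [hθ, pow_add]; ring

/-- **`SharpImpliesExp` holds** (item stmt-ValiantsHypothesis-13559, support of route
FreeFermionCLL): the sharp rank law `SharpRankLaw` (constant `C`) implies the exchange-rate law
`ExpRankLaw` with `θ = e⁻¹` and `C' = C + 2`; the case `n = 0`, where the sharp law is silent, is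
Cauchy–Schwarz `‖permMass‖² ≤ 0!·coeffNormSq`. [folklore] -/
theorem sharpImpliesExp_proof :
    Summit.ValiantsHypothesis.ValiantsHypothesis.Theses.FreeFermionCLL.SharpImpliesExp := by
  unfold Summit.ValiantsHypothesis.ValiantsHypothesis.Theses.FreeFermionCLL.SharpImpliesExp
    Summit.ValiantsHypothesis.ValiantsHypothesis.Theses.FreeFermionCLL.SharpRankLaw
    Summit.ValiantsHypothesis.ValiantsHypothesis.Theses.FreeFermionCLL.ExpRankLaw
  rintro ⟨C, hC⟩
  refine ⟨C + 2, Real.exp (-1), Real.exp_pos _, Real.exp_lt_one_iff.2 (by norm_num),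
    fun n R K κ => ?_⟩
  exact sharp_to_exp_bookkeeping (coeffNormSq_nonneg _) (norm_permMass_sq_le _)
    (hC n R K κ)

end Summit.ValiantsHypothesis.ValiantsHypothesis.Theorems.FreeFermionCLL
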